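import Mathlib
import Literature.NumberTheory.Sieve.LinearEquationsInPrimes
import Literature.NumberTheory.Sieve.LevelOfDistribution

/-!
# Sketch — first lemmas for the crux idea cards on `TupleLevelOne` (stmt-Parity-14833)

crux-ideate round 1, ideator 1 (planner-cruxidea-stmt-Parity-14833-1-0).
Nothing here is a route item; these are the `First lemma:` signatures of the cards
`Ideas/extremal-class-coherence.md`, `Ideas/half-range-slot-induction.md`, `Ideas/factorable-moduli-uniform-smoothing.md`.
IMPORT-LIGHT VARIANT (filed copy): does not import the route file (the farm reported the route olean
incoherent after the BROKEN rewrite of 2026-08-15T22:35Z); the crux is therefore referenced through the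
verbatim re-spelling `TupleLevelOne'` below instead of by name. The folder copy `Sketch.lean` imports
`Summits.Parity.GeneralizedHardyLittlewood.Theses.InverseSieveTuples` and states `CoherentReduction` /
`WeakOfStrong` against `…InverseSieveTuples.TupleLevelOne` BY NAME (rc 0 there).
-/

namespace Summit.Parity.GeneralizedHardyLittlewood.Cruxes.TupleLevelOne.Sketch

open Literature.NumberTheory.Sieve
open scoped BigOperators

/-- The tuple weight `Λ_Ψ(n) = ∏ᵢ Λ(ψᵢ(n))` of a one-dimensional system. -/
noncomputable def tupleWeight {t : ℕ} (Ψ : Fin t → AffLinForm 1) (n : ℤ) : ℝ :=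
  ∏ i, intVonMangoldt ((Ψ i).eval (fun _ => n))

/-- Class sum `A_Ψ([u,v]; d, r) = Σ_{u ≤ n ≤ v, n ≡ r (d)} Λ_Ψ(n)` (the crux's inner sum). -/
noncomputable def classSum {t : ℕ} (Ψ : Fin t → AffLinForm 1) (u v : ℤ) (d : ℕ) (r : ℤ) : ℝ :=
  ∑ n ∈ (Finset.Icc u v).filter (fun n : ℤ => n ≡ r [ZMOD (d : ℤ)]), tupleWeight Ψ n

/-- Full sum `A_Ψ([u,v]) = Σ_{u ≤ n ≤ v} Λ_Ψ(n)`. -/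
noncomputable def fullSum {t : ℕ} (Ψ : Fin t → AffLinForm 1) (u v : ℤ) : ℝ :=
  ∑ n ∈ Finset.Icc u v, tupleWeight Ψ n

/-- The crux's admissible-class weight `w_Ψ(d, r)` (verbatim shape of `TupleLevelOne`). -/
noncomputable def admWeight {t : ℕ} (Ψ : Fin t → AffLinForm 1) (d : ℕ) (r : ℤ) : ℝ :=
  if ∀ i, Int.gcd ((Ψ i).eval (fun _ => r)) (d : ℤ) = 1 then
    (((Finset.Ico (0 : ℤ) (d : ℤ)).filter
      (fun ρ : ℤ => ∀ i, Int.gcd ((Ψ i).eval (fun _ => ρ)) (d : ℤ) = 1)).card : ℝ)⁻¹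
  else 0

/-- Relative class discrepancy `Δ_Ψ([u,v]; d, r) = A_Ψ([u,v]; d, r) − w_Ψ(d,r) A_Ψ([u,v])`. -/
noncomputable def disc {t : ℕ} (Ψ : Fin t → AffLinForm 1) (u v : ℤ) (d : ℕ) (r : ℤ) : ℝ :=
  classSum Ψ u v d r - admWeight Ψ d r * fullSum Ψ u v

/-- The crux re-spelled through `disc` (sanity: same quantifier block as `TupleLevelOne`). -/
def TupleLevelOne' : Prop :=
  ∀ (t L : ℕ), 1 ≤ t → ∀ δ B : ℝ, 0 < δ → ∃ C : ℝ, ∀ N : ℕ, 2 ≤ N →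
    ∀ Ψ : Fin t → AffLinForm 1, IsNondegenerateSystem Ψ → affLinSize Ψ N ≤ L →
    ∀ (u v r : ℕ → ℤ), (∀ d, -(N : ℤ) ≤ u d) → (∀ d, v d ≤ N) →
    ∑ d ∈ Finset.Icc 1 ⌊(N : ℝ) ^ (1 - δ)⌋₊, |disc Ψ (u d) (v d) d (r d)|
      ≤ C * (N : ℝ) / Real.log N ^ B

/-! ## Card `extremal-class-coherence` -/

/-- **WeakTupleLevel H** — the COHERENT-RESIDUE (weak-sense, Fouvry–Radziwiłł (eq:goal)-shaped)
tuple Elliott–Halberstam statement: the residue map is induced by ONE rational `−b/a` of height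
`0 < |a| ≤ H`, `|b| ≤ H·N` (only moduli coprime to `a` are summed), absolute values over the
moduli, sup over intervals, level `N^{1−δ}`, every `δ`, every log-power. This is exactly the shape
that `SieveStep` consumes (`r_d ≡ −b_t · ā_t`), and for `t = 1` it is the 'major open problem'
(eq:goal) of arXiv:1811.08672 p.1 for every `δ`. -/
def WeakTupleLevel (H : ℕ) : Prop :=
  ∀ (t L : ℕ), 1 ≤ t → ∀ δ B : ℝ, 0 < δ → ∃ C : ℝ, ∀ N : ℕ, 2 ≤ N →
    ∀ Ψ : Fin t → AffLinForm 1, IsNondegenerateSystem Ψ → affLinSize Ψ N ≤ L →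
    ∀ (a b : ℤ), a ≠ 0 → |a| ≤ H → |b| ≤ H * N →
    ∀ (u v r : ℕ → ℤ), (∀ d, -(N : ℤ) ≤ u d) → (∀ d, v d ≤ N) →
    (∀ d : ℕ, Int.gcd a (d : ℤ) = 1 → a * r d + b ≡ 0 [ZMOD (d : ℤ)]) →
    ∑ d ∈ (Finset.Icc 1 ⌊(N : ℝ) ^ (1 - δ)⌋₊).filter (fun d : ℕ => Int.gcd a (d : ℤ) = 1),
        |disc Ψ (u d) (v d) d (r d)| ≤ C * (N : ℝ) / Real.log N ^ B

/-- **ExtremalClassCoherence H** (ECC, the derandomization / inverse conjecture of the card): a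
macroscopic total deviation forces a macroscopic deviation carried by moduli on which the residue
map AGREES WITH A SINGLE RATIONAL `−b/a` of height `(H, H·N)`. -/
def ExtremalClassCoherence (H : ℕ) : Prop :=
  ∀ (t L : ℕ), 1 ≤ t → ∀ δ B : ℝ, 0 < δ → ∃ B' C : ℝ, ∀ N : ℕ, 2 ≤ N →
    ∀ Ψ : Fin t → AffLinForm 1, IsNondegenerateSystem Ψ → affLinSize Ψ N ≤ L →
    ∀ (u v r : ℕ → ℤ), (∀ d, -(N : ℤ) ≤ u d) → (∀ d, v d ≤ N) →
    C * (N : ℝ) / Real.log N ^ B ≤ ∑ d ∈ Finset.Icc 1 ⌊(N : ℝ) ^ (1 - δ)⌋₊, |disc Ψ (u d) (v d) d (r d)| →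
    ∃ a b : ℤ, a ≠ 0 ∧ |a| ≤ H ∧ |b| ≤ H * N ∧
      (N : ℝ) / Real.log N ^ B' ≤
        ∑ d ∈ (Finset.Icc 1 ⌊(N : ℝ) ^ (1 - δ)⌋₊).filter
            (fun d : ℕ => Int.gcd a (d : ℤ) = 1 ∧ a * r d + b ≡ 0 [ZMOD (d : ℤ)]),
          |disc Ψ (u d) (v d) d (r d)|

/-- **First lemma of the card (pure logic + finiteness of the small-`N` sup):**
coherence of extremal classes and the weak form together give the crux BY NAME. -/
def CoherentReduction : Prop :=
  ∀ H : ℕ, 1 ≤ H → ExtremalClassCoherence H → WeakTupleLevel H →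
    TupleLevelOne'

/-- The converse direction that makes the weak form a genuine COROLLARY of the crux (so the line
is not circular): the crux implies `WeakTupleLevel H` for every `H`. -/
def WeakOfStrong : Prop :=
  ∀ H : ℕ, TupleLevelOne' → WeakTupleLevel H

/-! ## Card `half-range-slot-induction` -/

/-- **First lemma (provable now, Mathlib `moebius_mul_log_eq_vonMangoldt`): the slot split with the
complementary-divisor switch.** For `m ≥ 1`, `E ≥ 1`:
`Λ(m) = Σ_{e ∣ m, e ≤ E} μ(e) log(m/e) + Σ_{j ∣ m, j·E < m} μ(m/j) log j`. -/
def SlotSplit : Prop :=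
  ∀ (m E : ℕ), 0 < m → 0 < E →
    (ArithmeticFunction.vonMangoldt m : ℝ) =
      (∑ e ∈ m.divisors.filter (fun e : ℕ => e ≤ E),
          (ArithmeticFunction.moebius e : ℝ) * Real.log ((m : ℝ) / e)) +
      (∑ j ∈ m.divisors.filter (fun j : ℕ => j * E < m),
          (ArithmeticFunction.moebius (m / j) : ℝ) * Real.log (j : ℝ))

/-- Empty-joint-class lemma (provable now, elementary): if `r` is `Ψ`-admissible mod `d` and
`gcd(e, d) > 1` then no `n ≡ r (d)` has `e ∣ ψ(n)` for a form `ψ` of the system — so after the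
slot split only moduli `e`, `j` COPRIME to `d` occur. Stated for one affine form `a n + b`. -/
def EmptyJointClass : Prop :=
  ∀ (a b r n : ℤ) (d e : ℕ), Int.gcd (a * r + b) (d : ℤ) = 1 → n ≡ r [ZMOD (d : ℤ)] →
    (e : ℤ) ∣ a * n + b → Nat.gcd e d = 1

/-- The residual of the slot-induction line at moduli `d ≤ N^{1/2−δ'}` for `t ≥ 2`:
**TOP-balance** — class-independence (over `Ψ`-admissible classes `r mod d`) of the switched
('TOP', `j`-small) piece `TOP_Ψ([u,v]; d, r) = Σ_{j ≥ 1, j·E_d < ·} Σ_{n ≡ r (d), j ∣ ψ_{t-1}(n)}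
(∏_{i<t-1} Λ(ψ_i n)) μ(ψ_{t-1}(n)/j) log j` with `E_d = N^{1−δ'}/d`. Spelled here for the
LAST form of the system with the cut `j * E < ψ(n)` made explicit through `SlotSplit`. -/
noncomputable def topPiece {t : ℕ} (Ψ : Fin (t + 1) → AffLinForm 1) (E : ℕ) (u v : ℤ) (d : ℕ)
    (r : ℤ) : ℝ :=
  ∑ n ∈ (Finset.Icc u v).filter (fun n : ℤ => n ≡ r [ZMOD (d : ℤ)]),
    (∏ i : Fin t, intVonMangoldt ((Ψ (Fin.castSucc i)).eval (fun _ => n))) *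
      (let m : ℕ := ((Ψ (Fin.last t)).eval (fun _ => n)).toNat
       ∑ j ∈ m.divisors.filter (fun j : ℕ => j * E < m),
          (ArithmeticFunction.moebius (m / j) : ℝ) * Real.log (j : ℝ))

/-- **TOPBalance** (the open residual of the half-range line; parity-type but RELATIVE — no main
term is asserted, only class-independence): -/
def TOPBalance : Prop :=
  ∀ (t L : ℕ), 1 ≤ t → ∀ δ δ' B : ℝ, 0 < δ → 0 < δ' → ∃ C : ℝ, ∀ N : ℕ, 2 ≤ N →
    ∀ Ψ : Fin (t + 1) → AffLinForm 1, IsNondegenerateSystem Ψ → affLinSize Ψ N ≤ L →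
    ∀ (u v r r' : ℕ → ℤ), (∀ d, -(N : ℤ) ≤ u d) → (∀ d, v d ≤ N) →
    (∀ d, ∀ i, Int.gcd ((Ψ i).eval (fun _ => r d)) (d : ℤ) = 1) →
    (∀ d, ∀ i, Int.gcd ((Ψ i).eval (fun _ => r' d)) (d : ℤ) = 1) →
    ∑ d ∈ Finset.Icc 1 ⌊(N : ℝ) ^ (1 / 2 - δ')⌋₊,
        |topPiece Ψ ⌊(N : ℝ) ^ (1 - δ) / d⌋₊ (u d) (v d) d (r d)
          - topPiece Ψ ⌊(N : ℝ) ^ (1 - δ) / d⌋₊ (u d) (v d) d (r' d)|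
      ≤ C * (N : ℝ) / Real.log N ^ B


/-! ## Card `factorable-moduli-uniform-smoothing` -/

/-- **Maynard III, Theorem 1.1 in ψ-normalisation (vendoring candidate; arXiv:2006.08250 = Memoirs AMS
1544 (2025), Thm 1.1 'Uniform equidistribution of primes with weak error term').** For a sufficiently
large absolute `C` and `δ > 0`: for `Q₁ ≤ x^{1/10−3δ}/(log x)^C`, `Q₂ ≤ x^{4/10+4δ}(log x)^C`,
`Σ_{q₁ ~ Q₁} Σ_{q₂ ~ Q₂} sup_{(a, q₁q₂)=1} |ψ(x; q₁q₂, a) − ψ(x)/φ(q₁q₂)| ≪_C δ·x + x (log log x)²/log x`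
— COMPLETE uniformity in the residue class beyond `x^{1/2}` (printed for `π`; the `ψ`-form is partial
summation). Unproved here; a grounder should vendor the printed `π`-form as a named fact. -/
def MaynardIII_thm11_psi : Prop :=
  ∃ C₀ : ℝ, ∀ C : ℝ, C₀ ≤ C → ∀ δ : ℝ, 0 < δ → ∃ K x₀ : ℝ, ∀ x : ℝ, x₀ ≤ x →
    ∀ Q₁ Q₂ : ℝ, 1 ≤ Q₁ → Q₁ ≤ x ^ (1 / 10 - 3 * δ) / Real.log x ^ C →
      1 ≤ Q₂ → Q₂ ≤ x ^ (4 / 10 + 4 * δ) * Real.log x ^ C →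
    ∑ q₁ ∈ Finset.Icc ⌈Q₁⌉₊ ⌊2 * Q₁⌋₊, ∑ q₂ ∈ Finset.Icc ⌈Q₂⌉₊ ⌊2 * Q₂⌋₊,
        (⨆ a : (ZMod (q₁ * q₂))ˣ,
          |LevelOfDistribution.chebyshevPsiMod (q₁ * q₂) (a : ZMod (q₁ * q₂)) x
            - (∑ n ∈ Finset.range (⌊x⌋₊ + 1), (ArithmeticFunction.vonMangoldt n : ℝ))
                / Nat.totient (q₁ * q₂)|)
      ≤ K * (δ * x + x * Real.log (Real.log x) ^ 2 / Real.log x)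

/-- **First lemma of the card (M-sized bookkeeping, provable once `MaynardIII_thm11_psi` is vendored):**
the factorable-moduli, level-`1/2+δ₀`, weak-error SLICE of the crux at `t = 1` for the identity form —
the crux's relative discrepancy `disc` summed over moduli `d = q₁q₂` in Maynard's ranges, full interval
`[1, N]`, any residue map. (Relative vs. absolute main term: `w(d,r)·ψ(N) = ψ(N)/φ(d)` on coprime
classes up to the `O(log N · ω(d))` non-coprime prime powers.) -/
def FactorableSlice : Prop :=
  MaynardIII_thm11_psi →
  ∀ δ : ℝ, 0 < δ → δ < 1 / 1000 → ∃ K : ℝ, ∃ N₀ : ℕ, ∀ N : ℕ, N₀ ≤ N →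
    ∀ Ψ : Fin 1 → AffLinForm 1, (Ψ 0).coeff = (fun _ => 1) → (Ψ 0).const = 0 →
    ∀ (r : ℕ → ℤ) (Q₁ Q₂ : ℝ), 1 ≤ Q₁ → Q₁ ≤ (N : ℝ) ^ (1 / 10 - 4 * δ) →
      1 ≤ Q₂ → Q₁ * Q₂ ≤ (N : ℝ) ^ (1 / 2 + δ) →
    ∑ q₁ ∈ Finset.Icc ⌈Q₁⌉₊ ⌊2 * Q₁⌋₊, ∑ q₂ ∈ Finset.Icc ⌈Q₂⌉₊ ⌊2 * Q₂⌋₊,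
        |disc Ψ 1 N (q₁ * q₂) (r (q₁ * q₂))|
      ≤ K * (δ * N + N * Real.log (Real.log N) ^ 2 / Real.log N)

end Summit.Parity.GeneralizedHardyLittlewood.Cruxes.TupleLevelOne.Sketch
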